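import Summits.QuantumFields.YangMills.Theorems.AlphaInputsT3ACv3ProfileLargeE
import Summits.QuantumFields.YangMills.Theorems.AlphaInputsT3ACv3CoreNonempty
import Summits.QuantumFields.YangMills.Theorems.BalabanUVNodesN08AlphaProfileGroupSU
import HarnessLib

/-!
# `AlphaInputsT3ACv3CoreNonemptyE` — STRATEGY B for 2′, (D6L)-CORE FORK, PART F5e′ + ASSEMBLY: THE UNCHARGED HALF OF (D6L) IS A THEOREM UNDER THE COLLAR ROW (N2′)
# AND `4π ≤ C68` — lane `pub-balaban3d`, seat alpha-2 (g3)

WHAT (HOME `D6-AUDIT-alpha2-g2.md` §7, F5e′ + ASSEMBLY).  §1 (generic) the near-reads smallness of the enlarged-region profile: a fine plaquette whose base point is within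
`ℓ¹`-distance `39·L^{i₀}` of a site of `Ω_i(h)` (`i₀ ≤ i ≤ k`) has its base point in `Ω′_i(h)`, so by F5c′ (`dist1_plaqVar_profE_le_of_corner`) it is `½C68·a_i·L^{−2i₀}`-small
(`dist1_plaqHol_profE_le_near`).  §2 (T³ objects, `d = 3`, `N = 2`): the collar row (N2′) at the T³ scales is F5c′'s `CollarE (T3Scales F γ … K) 𝔠 K` (`39·L + 16 ≤ Rcol_j`, `j + 1 ≤ K`; `collarE_mono`),
the interface's [B7]-Prop-2 window for `α₀ := C68·a_j` from `b7Window_T3` (`C₀(3) = 226·224² ≥ 143·(49/4)²`, `δ_SU(2) = ⅓`, `c₂′(3,L) = 1/(14336L²)`), NODE O's `SmallOK` on the record's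
window, the GUARDED geometric hook `localSmallT3_of_plaqSmall_near_reads'` (smallness asked only near ACTUAL read sites), and ★★ `AlphaInputsT3AC.core_nonempty_of_collar`:
under `CollarE … K` and `4π ≤ C68`, for every `k ≤ K` and every ADMISSIBLE history `h` the W-independent core `localSmallT3 k h ∩ regClassC k h ∩ large67Set k h` of the localised
adapted class contains the enlarged-region profile `profE` (direction `suDir ∈ 𝔰𝔲(2) ∖ 0`; `profE_mem_regClassC`, `hLarge_profE`, §1 with `α₀ := C68·max_{i ≤ k} a_i`); hence ★★
`adaptedClassT3L_nonempty_of_not_charged_of_collar` — THE UNCHARGED HALF OF (D6L) `AdaptedClassNonemptyT3L` under two constants side conditions and nothing else.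
LOCATED (typing; §3).  p546079's displayed row `RegularProfileNearT3` asks `dist1 < α₀·L^{−2i₀}` for every fine plaquette with `distTo (lam42 Ω(h) k i) q.src ≤ 39·L^{i₀}`; since
`distTo ∅ = 0` (`ℕ`-infimum), at a history with an EMPTY read region `lam42 Ω(h) k i` (e.g. `Ω_k(h) = ∅` after a covering passage) that clause is GLOBAL — stronger than the interface
`localSmallT3_of_plaqSmall_near_reads` uses (it reads plaquettes near actual read bonds only) and not met by the profile near lower recorded plaquettes.  §3 PROVES the GUARDED
form of that row from the collar — ★ `exists_regular_large_nearSmall_of_collar` (smallness asked for `∃ y ∈ lam42 …, tdist q.src y ≤ 39·L^{i₀}`; no new definition) — so nothing of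
p546079 is lost (its two theorems stay valid; its row is simply not the one the fork discharges).
HONEST FRAMING.  Kernel construction + plumbing; the two side conditions (N2′) `CollarE … K` (a carrier-constants condition `⌈R₁r(g_j)⌉M₁ ≥ 39L + 16`) and `4π ≤ C68` stay hypotheses
here (the sibling `…DataSchemaLC` derives them from record sizes);
nothing of [B10]∕[7]∕[4]'s estimates asserted beyond the tree's theorems; count-neutral helper toward R3 2′ (`stub_laneRecordsV3`, items 19935∕19936); the CHARGED half of (D6L) is not
addressed; nothing about d = 4, the continuum, or a mass gap.

References: T. Bałaban, Commun. Math. Phys. 102 (1985) 255–275 [Balaban1985UV3] ((39)–(42) p.266, (67)–(68) p.273); CMP 98 (1985) 17–51 [Balaban1985Averaging] (Props. 1–2 p.26);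
CMP 102 (1985) 277–309 [Balaban1985Variational] ((2)+(8) pp.278–279).
-/

set_option autoImplicit false

noncomputable section

/-! ## §1 Near-reads smallness of the enlarged-region profile (generic scales and group) -/

namespace Summit.QuantumFields.YangMills.Theorems.ProfileEnlarged

open scoped Matrix.Norms.L2Operator
open Literature.MathematicalPhysics.QuantumFieldTheory.Balaban1983to89
open Literature.MathematicalPhysics.QuantumFieldTheory.Balaban1985CMP102
open Literature.MathematicalPhysics.QuantumFieldTheory.Balaban1985CMP102.Setting
open Summit.QuantumFields.Balaban3D.Carriers
open Summit.QuantumFields.Balaban3D.Proofs.Primitives (AlphaConsts)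
open Summit.QuantumFields.YangMills.Theorems.BalabanUVNodesN08AlphaProfileBuild (aj aj_pos)

variable {L : ℕ} (S : Scales L) {G : Type} [GaugeGroup G] [MeasurableSpace G] {𝔊 : GroupModel G} (𝔠 : AlphaConsts L 𝔊.N)
  {X : Matrix (Fin 𝔊.N) (Fin 𝔊.N) ℂ} (hX : X ∈ 𝔊.lie) {k : ℕ} (h : Hist S.P k)

/-- A fine plaquette with base point in `Ω′_i(h)` (`i ≤ k ≤ K`, collars (N2′)) is `½C68·a_i·L^{−2i}`-small for the enlarged-region profile (F5c′ at the corner `q.src`).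
[cite: Balaban1985UV3, (68) p.273] -/
theorem dist1_plaqHol_profE_le_of_mem_OmegaE (hX0 : X ≠ 0) (hk : k ≤ S.K) (hR : CollarE S 𝔠 k) {i : ℕ} (hi : i ≤ k) (q : Plaq S.P 0)
    (hq : q.src ∈ OmegaE 𝔠.lane.carrier.M₁ (rcolOf S 𝔠.lane.carrier) k h i) :
    dist1 (GaugeField.plaqHol (profE S 𝔠 h hX) q) ≤ 𝔠.C68 / 2 * aj S 𝔠 i * (((L : ℝ) ^ i)⁻¹) ^ 2 :=
  dist1_plaqVar_profE_le_of_corner S 𝔠 h hX hX0 hk hR q.src (ne_of_lt q.hμν) hi (Or.inl hq)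

/-- **★ NEAR-READS SMALLNESS (F5e′)**: a fine plaquette whose base point is within `ℓ¹`-distance `39·L^{i₀}` of a site of a subset `T ⊆ Ω_i(h)` (`i₀ ≤ i ≤ k ≤ K`, collars (N2′)) is
`½C68·a_i·L^{−2i₀}`-small for the enlarged-region profile. [cite: Balaban1985UV3, (68) p.273] -/
theorem dist1_plaqHol_profE_le_near (hX0 : X ≠ 0) (hk : k ≤ S.K) (hR : CollarE S 𝔠 k) {i₀ i : ℕ} (hi₀ : i₀ ≤ i) (hi : i ≤ k)
    {T : Set (Site S.P 0)} (hT : T ⊆ Omega 𝔠.lane.carrier.M₁ (rcolOf S 𝔠.lane.carrier) k h i) (q : Plaq S.P 0) {y : Site S.P 0} (hy : y ∈ T)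
    (hd : Site.tdist q.src y ≤ 39 * S.P.L ^ i₀) :
    dist1 (GaugeField.plaqHol (profE S 𝔠 h hX) q) ≤ 𝔠.C68 / 2 * aj S 𝔠 i * (((L : ℝ) ^ i₀)⁻¹) ^ 2 := by
  have hq : q.src ∈ OmegaE 𝔠.lane.carrier.M₁ (rcolOf S 𝔠.lane.carrier) k h i := by
    refine ⟨y, hT hy, hd.trans ?_⟩
    unfold enlRad
    have : S.P.L ^ i₀ ≤ S.P.L ^ i := Nat.pow_le_pow_right S.P.L_pos hi₀
    omega
  refine (dist1_plaqHol_profE_le_of_mem_OmegaE S 𝔠 hX h hX0 hk hR hi q hq).trans ?_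
  have hL1 : (1 : ℝ) ≤ L := by exact_mod_cast le_of_lt S.hL.2
  have hC : 0 ≤ 𝔠.C68 / 2 * aj S 𝔠 i := by
    have := 𝔠.C68_pos.le; have := (aj_pos S 𝔠 (hi.trans hk)).le; positivity
  refine mul_le_mul_of_nonneg_left ?_ hC
  have h0 : (0 : ℝ) < (L : ℝ) ^ i₀ := by positivity
  have hle : (L : ℝ) ^ i₀ ≤ (L : ℝ) ^ i := pow_le_pow_right₀ hL1 hi₀
  gcongr

/-- The collar row (N2′) at `K` gives it at every `k ≤ K`. [folklore] -/
theorem collarE_mono {K' k' : ℕ} (hR : CollarE S 𝔠 K') (hk : k' ≤ K') : CollarE S 𝔠 k' :=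
  fun j hj => hR j (hj.trans hk)

end Summit.QuantumFields.YangMills.Theorems.ProfileEnlarged

/-! ## §2 At the T³ objects: the collar row, the window, the guarded hook, and the uncharged half of (D6L) -/

namespace Summit.QuantumFields.YangMills.Theorems

open Set
open Literature.MathematicalPhysics.QuantumFieldTheory.Balaban1983to89
open Literature.MathematicalPhysics.QuantumFieldTheory.Balaban1983to89.B10 (pFun)
open Literature.MathematicalPhysics.QuantumFieldTheory.Balaban1983to89.ExpMeanLog (deltaSU)
open Literature.MathematicalPhysics.QuantumFieldTheory.Balaban1983to89.T3ContinuumYM3Torus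
open Literature.MathematicalPhysics.QuantumFieldTheory.Balaban1983to89.B10Eq38TorusDomains (toFine)
open Literature.MathematicalPhysics.QuantumFieldTheory.Balaban1983to89.B10Eq42TorusConstraint (bondsIn lam42 mem_bondsIn_iff)
open Literature.MathematicalPhysics.QuantumFieldTheory.Balaban1985CMP102.Setting
open Summit.QuantumFields.Balaban3D.Carriers
open Summit.QuantumFields.Balaban3D.Proofs.Primitives (AlphaConsts)
open Summit.QuantumFields.Balaban3D.Proofs.ScalesArithmetic (gk_pos)
open Summit.QuantumFields.YangMills.BalabanUVNodes.N20LCSAvgDominationRegion (boxRegion mem_boxRegion)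
open Summit.QuantumFields.YangMills.Theorems.BalabanUVNodesN08AlphaCompactSel (regClassC)
open Summit.QuantumFields.YangMills.Theorems.BalabanUVNodesN08AlphaHistGeom (distTo distTo_le exists_tdist_eq_distTo)
open Summit.QuantumFields.YangMills.Theorems.BalabanUVNodesN08AlphaProfileBuild (aj aj_pos R0)
open Summit.QuantumFields.YangMills.Theorems.BalabanUVNodesN08AlphaProfileLarge (SmallOK)
open Summit.QuantumFields.YangMills.Theorems.BalabanUVNodesN08AlphaProfileGroupSU (exists_ne_zero_mem_lie_su)
open Summit.QuantumFields.YangMills.Theorems.ProfileEnlarged (CollarE collarE_mono profE profE_mem_regClassC hLarge_profE dist1_plaqHol_profE_le_near)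
open B7Prop2Explicit (C0 c2')

/-- `lam42 Ω k i ⊆ Ω i` for `i ≤ k` (`Λ_i = Ω_i ∖ Ω_{i+1}` below the top, `Ω_k` at the top). [cite: Balaban1985UV3, (42) p.266] -/
theorem lam42_subset_of_le {P : Params} (Ω : ℕ → Set (Site P 0)) {k i : ℕ} (hik : i ≤ k) : lam42 Ω k i ⊆ Ω i := by
  intro x hx
  unfold lam42 at hx
  split_ifs at hx with hlt
  · exact hx.1
  · have : i = k := le_antisymm hik (not_lt.mp hlt)
    subst this
    exact hx

section T3

variable {F : T3Family} {𝔠 : AlphaConsts F.L (suGroupModel 2).N} {γ : ℝ} {hγ : 0 < γ} {hγ1 : γ ≤ (min 𝔠.gamma0 1) ^ 2} {K : ℕ}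

/-- NODE O's smallness `C68·a_j ≤ ¼` holds on the record's window at every `j ≤ K` (`C₀(3)·C68·a_j ≤ ⅓`, `C₀(3) ≥ 1`). [cite: Balaban1985Averaging, Prop. 2 (54) p.26] -/
theorem AlphaInputsT3AC.smallOK_T3 {k : ℕ} (hk : k ≤ K) : SmallOK (T3Scales F γ hγ (hγ1.trans (sq_min_one_le _ 𝔠.gamma0_pos)) K) 𝔠 k := by
  intro j hj
  have h1 := (AlphaInputsT3AC.b7Window_T3 F 𝔠 γ hγ hγ1 K (show j ≤ K by omega)).1
  have hC0 : (4 : ℝ) / 3 ≤ C0 3 := by unfold C0; norm_num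
  have ha : 0 ≤ 𝔠.C68 * aj (T3Scales F γ hγ (hγ1.trans (sq_min_one_le _ 𝔠.gamma0_pos)) K) 𝔠 j :=
    mul_nonneg 𝔠.C68_pos.le (aj_pos _ 𝔠 (show j ≤ K by omega)).le
  change C0 3 * (𝔠.C68 * aj (T3Scales F γ hγ (hγ1.trans (sq_min_one_le _ 𝔠.gamma0_pos)) K) 𝔠 j) ≤ 1 / 3 at h1
  nlinarith

/-- **THE INTERFACE'S [B7]-PROP-2 WINDOW FOR `α₀ := C68·a_j`** (`j ≤ K`) on the record's window: `143·(49/4)²·α₀ ≤ ⅓`, `2α₀ ≤ 2δ_SU(2)/(7L)²`, `((5L)²/4)(α₀ + 2·143·(49/4)²·α₀²) ≤ δ_SU(2)/2`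
— from `b7Window_T3` (`C₀(3) = 226·224²`, `c₂′(3,L) = 1/(14336·L²)`, `δ_SU(2) = ⅓`). [cite: Balaban1985Averaging, Prop. 2 (52)–(54) p.26] -/
theorem AlphaInputsT3AC.b7WindowNear_T3 {j : ℕ} (hj : j ≤ K) :
    0 < 𝔠.C68 * aj (T3Scales F γ hγ (hγ1.trans (sq_min_one_le _ 𝔠.gamma0_pos)) K) 𝔠 j ∧
    (143 * ((((3 + 4 : ℕ) : ℝ)) ^ 2 / 4) ^ 2) * (𝔠.C68 * aj (T3Scales F γ hγ (hγ1.trans (sq_min_one_le _ 𝔠.gamma0_pos)) K) 𝔠 j) ≤ 1 / 3 ∧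
    2 * (𝔠.C68 * aj (T3Scales F γ hγ (hγ1.trans (sq_min_one_le _ 𝔠.gamma0_pos)) K) 𝔠 j) ≤ 2 * deltaSU (Fin 2) / (((3 + 4) * F.L : ℕ) : ℝ) ^ 2 ∧
    ((((3 + 2) * F.L : ℕ) : ℝ) ^ 2 / 4) * ((𝔠.C68 * aj (T3Scales F γ hγ (hγ1.trans (sq_min_one_le _ 𝔠.gamma0_pos)) K) 𝔠 j) +
      2 * (143 * ((((3 + 4 : ℕ) : ℝ)) ^ 2 / 4) ^ 2) * (𝔠.C68 * aj (T3Scales F γ hγ (hγ1.trans (sq_min_one_le _ 𝔠.gamma0_pos)) K) 𝔠 j) ^ 2) ≤ deltaSU (Fin 2) / 2 := by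
  obtain ⟨h1, h2, h3⟩ := AlphaInputsT3AC.b7Window_T3 F 𝔠 γ hγ hγ1 K hj
  set α : ℝ := 𝔠.C68 * aj (T3Scales F γ hγ (hγ1.trans (sq_min_one_le _ 𝔠.gamma0_pos)) K) 𝔠 j with hα
  have hαpos : 0 < α := mul_pos 𝔠.C68_pos (aj_pos _ 𝔠 hj)
  change C0 3 * α ≤ 1 / 3 at h1
  change 2 * α ≤ c2' 3 F.L at h2
  change 512 * (((3 : ℕ) : ℝ) + 1) * ((3 : ℕ) + 4) * (F.L : ℝ) ^ 2 * (α + 2 * C0 3 * α ^ 2) ≤ 1 at h3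
  have hL1 : (1 : ℝ) ≤ F.L := by exact_mod_cast le_of_lt F.hL.2
  have hL0 : (0 : ℝ) < F.L := by linarith
  have hC0' : (143 * ((((3 + 4 : ℕ) : ℝ)) ^ 2 / 4) ^ 2) ≤ C0 3 := by unfold C0; norm_num
  have hc2 : c2' 3 F.L = 1 / (14336 * (F.L : ℝ) ^ 2) := by unfold c2'; norm_num
  have hδ : deltaSU (Fin 2) = 1 / 3 := by
    unfold deltaSU
    rw [Fintype.card_fin]
    refine min_eq_left ?_
    have := Real.pi_gt_three
    push_cast
    linarith
  rw [hδ]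
  refine ⟨hαpos, ?_, ?_, ?_⟩
  · nlinarith
  · rw [hc2] at h2
    have hL2 : (0 : ℝ) < (F.L : ℝ) ^ 2 := by positivity
    rw [show ((((3 + 4) * F.L : ℕ) : ℝ)) ^ 2 = 49 * (F.L : ℝ) ^ 2 by push_cast; ring]
    rw [le_div_iff₀ (by positivity)]
    rw [le_div_iff₀ (by positivity)] at h2
    nlinarith
  · have hsq : α ^ 2 ≥ 0 := sq_nonneg α
    have hx : (F.L : ℝ) ^ 2 * (α + 2 * C0 3 * α ^ 2) ≤ 1 / 14336 := by
      have : 512 * (((3 : ℕ) : ℝ) + 1) * ((3 : ℕ) + 4) = 14336 := by norm_num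
      rw [this] at h3
      nlinarith
    have hy : (F.L : ℝ) ^ 2 * (α + 2 * (143 * ((((3 + 4 : ℕ) : ℝ)) ^ 2 / 4) ^ 2) * α ^ 2) ≤ (F.L : ℝ) ^ 2 * (α + 2 * C0 3 * α ^ 2) := by
      have hL2 : (0 : ℝ) ≤ (F.L : ℝ) ^ 2 := by positivity
      refine mul_le_mul_of_nonneg_left ?_ hL2
      nlinarith
    rw [show ((((3 + 2) * F.L : ℕ) : ℝ)) ^ 2 = 25 * (F.L : ℝ) ^ 2 by push_cast; ring]
    nlinarith

/-- **THE (D6L)-CORE INTERFACE, GUARDED GEOMETRIC FORM** (the variant of `localSmallT3_of_plaqSmall_near_reads` whose smallness hypothesis is asked only near ACTUAL read sites):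
`U ∈ localSmallT3 k h` (`k ≤ K`) as soon as, for all `i₀ ≤ i ≤ k`, every fine plaquette whose base point is within `ℓ¹` torus distance `39·L^{i₀}` of SOME SITE of the read region
`lam42 Ω(h) k i` is `α₀·(L^{i₀})⁻²`-small, `α₀` in [B7] Prop. 2's window at `d = 3`, `N = 2`. [cite: Balaban1985Averaging, Prop. 2 (52)–(54) p.26 + Prop. 1 (51) p.26; Balaban1985UV3, (42) p.266 + (68) p.273] -/
theorem AlphaInputsT3AC.localSmallT3_of_plaqSmall_near_reads' {k : ℕ} (hk : k ≤ K) (h : Hist (F.P K) k) {α₀ : ℝ} (hα : 0 < α₀)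
    (hα3 : (143 * ((((3 + 4 : ℕ) : ℝ)) ^ 2 / 4) ^ 2) * α₀ ≤ 1 / 3)
    (hα2 : 2 * α₀ ≤ 2 * deltaSU (Fin 2) / (((3 + 4) * F.L : ℕ) : ℝ) ^ 2)
    (hδ : ((((3 + 2) * F.L : ℕ) : ℝ) ^ 2 / 4) * (α₀ + 2 * (143 * ((((3 + 4 : ℕ) : ℝ)) ^ 2 / 4) ^ 2) * α₀ ^ 2) ≤ deltaSU (Fin 2) / 2)
    {U : GaugeField (F.P K) 0 (Matrix.specialUnitaryGroup (Fin 2) ℂ)}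
    (hU : ∀ i₀ i : ℕ, i₀ ≤ i → i ≤ k → ∀ q : Plaq (F.P K) 0,
      ∀ y ∈ lam42 (Omega 𝔠.lane.carrier.M₁ (rcolOf (T3Scales F γ hγ (hγ1.trans (sq_min_one_le _ 𝔠.gamma0_pos)) K) 𝔠.lane.carrier) k h) k i,
        Site.tdist q.src y ≤ 39 * F.L ^ i₀ → dist1 (GaugeField.plaqHol U q) < α₀ * (((F.L : ℝ) ^ i₀)⁻¹) ^ 2) :
    U ∈ AlphaInputsT3AC.localSmallT3 F 𝔠 γ hγ hγ1 K k h := by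
  refine AlphaInputsT3AC.localSmallT3_of_plaqSmallOn_readBoxes (𝔠 := 𝔠) (hγ1 := hγ1) hk h hα hα3 hα2 hδ fun i₀ hi₀ c₀ hc₀ q hq => ?_
  obtain ⟨i, hi₀i, hik, hb⟩ := hc₀
  have hmem : toFine i₀ c₀.src ∈ lam42 (Omega 𝔠.lane.carrier.M₁
      (rcolOf (T3Scales F γ hγ (hγ1.trans (sq_min_one_le _ 𝔠.gamma0_pos)) K) 𝔠.lane.carrier) k h) k i := (mem_bondsIn_iff.mp hb).1
  refine hU i₀ i hi₀i hik q _ hmem ?_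
  have ht := tdist_le_of_mem_boxRegion (Finset.mem_coe.mp hq)
  have hd : (F.P K).d = 3 := rfl
  rw [hd] at ht
  have hL : (F.P K).L = F.L := rfl
  omega

/-- **★★ THE W-INDEPENDENT CORE OF THE LOCALISED ADAPTED CLASS IS NON-EMPTY** under the collar row (N2′) `CollarE … K` and `4π ≤ C68`: for every `k ≤ K` and every ADMISSIBLE history
`h`, the enlarged-region profile `profE` (direction `suDir ∈ 𝔰𝔲(2) ∖ 0`) lies in `localSmallT3 k h ∩ regClassC k h ∩ large67Set k h` — `profE_mem_regClassC` (F5c′), `hLarge_profE`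
(F5d′), and the guarded hook fed by F5e′ with `α₀ := C68·max_{i ≤ k} a_i` in the window of `b7WindowNear_T3`.
[cite: Balaban1985UV3, (39)–(42) p.266 + (67)–(68) p.273; Balaban1985Variational, (2)+(8) pp.278–279; Balaban1985Averaging, Props. 1–2 p.26] -/
theorem AlphaInputsT3AC.core_nonempty_of_collar (hN2 : CollarE (T3Scales F γ hγ (hγ1.trans (sq_min_one_le _ 𝔠.gamma0_pos)) K) 𝔠 K) (hC : 4 * Real.pi ≤ 𝔠.C68)
    {k : ℕ} (hk : k ≤ K)
    {h : Hist (F.P K) k}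
    (hh : Hist.Admissible 𝔠.lane.carrier.M₁ (rcolOf (T3Scales F γ hγ (hγ1.trans (sq_min_one_le _ 𝔠.gamma0_pos)) K) 𝔠.lane.carrier) k h) :
    (AlphaInputsT3AC.localSmallT3 F 𝔠 γ hγ hγ1 K k h ∩
      (regClassC (S := T3Scales F γ hγ (hγ1.trans (sq_min_one_le _ 𝔠.gamma0_pos)) K) (suGroupModel 2) 𝔠 k h ∩
        AlphaInputsT3AC.large67Set F 𝔠 γ hγ hγ1 K k h)).Nonempty := by
  classical
  set S : Scales F.L := T3Scales F γ hγ (hγ1.trans (sq_min_one_le _ 𝔠.gamma0_pos)) K with hS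
  obtain ⟨X, hX, hX0⟩ := exists_ne_zero_mem_lie_su (N := 2) le_rfl
  have hR : CollarE S 𝔠 k := collarE_mono S 𝔠 hN2 hk
  have hkS : k ≤ S.K := hk
  refine ⟨profE S 𝔠 h hX, ?_, profE_mem_regClassC S 𝔠 h hX hX0 hkS hR,
    hLarge_profE S 𝔠 h hX hX0 hkS hR (AlphaInputsT3AC.smallOK_T3 (𝔠 := 𝔠) (hγ1 := hγ1) hk) hC hh⟩
  -- the localised small-loop class: the guarded hook with `α₀ := C68 · max_{i ≤ k} a_i`
  obtain ⟨im, him, hmax⟩ := Finset.exists_max_image (Finset.range (k + 1)) (aj S 𝔠) ⟨0, by simp⟩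
  have himk : im ≤ k := Nat.lt_succ_iff.mp (Finset.mem_range.mp him)
  obtain ⟨hα, hα3, hα2, hδ⟩ := AlphaInputsT3AC.b7WindowNear_T3 (F := F) (𝔠 := 𝔠) (γ := γ) (hγ := hγ) (hγ1 := hγ1) (K := K) (himk.trans hk)
  refine AlphaInputsT3AC.localSmallT3_of_plaqSmall_near_reads' (𝔠 := 𝔠) (hγ1 := hγ1) hk h hα hα3 hα2 hδ fun i₀ i hi₀ hi q y hy hd => ?_
  have hT := lam42_subset_of_le (Omega 𝔠.lane.carrier.M₁ (rcolOf S 𝔠.lane.carrier) k h) hi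
  have hle := dist1_plaqHol_profE_le_near S 𝔠 hX h hX0 hkS hR hi₀ hi hT q hy hd
  refine lt_of_le_of_lt hle ?_
  have hai : aj S 𝔠 i ≤ aj S 𝔠 im := hmax i (Finset.mem_range.mpr (Nat.lt_succ_of_le hi))
  have haim : 0 < aj S 𝔠 im := aj_pos S 𝔠 (himk.trans hk)
  have hC0 : 0 < 𝔠.C68 := 𝔠.C68_pos
  have hL0 : (0 : ℝ) < ((F.L : ℝ) ^ i₀)⁻¹ := by
    have : (0 : ℝ) < F.L := by exact_mod_cast (zero_lt_one.trans F.hL.2)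
    positivity
  have hlt : 𝔠.C68 / 2 * aj S 𝔠 i < 𝔠.C68 * aj S 𝔠 im := by nlinarith
  exact mul_lt_mul_of_pos_right hlt (by positivity)

/-- **★★ THE UNCHARGED HALF OF (D6L) UNDER THE TWO CONSTANTS SIDE CONDITIONS**: under `CollarE … K` and `4π ≤ C68`, for every `k ≤ K`, every admissible history `h` and every datum `W`
that is NOT charged (`¬ChargedT3 … k h W`), the localised adapted class `𝒞_L(k, h, W)` is non-empty (its guarded (42)/r3 clause is vacuous; the core by `core_nonempty_of_collar`).
[cite: Balaban1985UV3, (40)–(42) p.266 + (67)–(68) p.273] -/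
theorem AlphaInputsT3AC.adaptedClassT3L_nonempty_of_not_charged_of_collar
    (hN2 : CollarE (T3Scales F γ hγ (hγ1.trans (sq_min_one_le _ 𝔠.gamma0_pos)) K) 𝔠 K) (hC : 4 * Real.pi ≤ 𝔠.C68)
    {k : ℕ} (hk : k ≤ K) {h : Hist (F.P K) k}
    (hh : Hist.Admissible 𝔠.lane.carrier.M₁ (rcolOf (T3Scales F γ hγ (hγ1.trans (sq_min_one_le _ 𝔠.gamma0_pos)) K) 𝔠.lane.carrier) k h)
    (W : GaugeField (F.P K) k (Matrix.specialUnitaryGroup (Fin 2) ℂ))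
    (hW : ¬ ChargedT3 F γ 𝔠.b₀ 𝔠.p₀ (avgWindowFactor F.L) K 𝔠.lane.carrier.M₁
      (rcolOf (T3Scales F γ hγ (hγ1.trans (sq_min_one_le _ 𝔠.gamma0_pos)) K) 𝔠.lane.carrier) k h W) :
    (AlphaInputsT3AC.adaptedClassT3L F 𝔠 γ hγ hγ1 K k h W).Nonempty := by
  obtain ⟨U, hloc, hreg, hL⟩ := AlphaInputsT3AC.core_nonempty_of_collar hN2 hC hk hh
  exact ⟨U, hloc, hreg, hL, fun hc => absurd hc hW⟩

/-! ## §3 The displayed row of p546079 in GUARDED form is a theorem under the collar -/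

/-- **★ THE GUARDED FORM OF p546079's ROW `RegularProfileNearT3` IS A THEOREM UNDER THE COLLAR ROW (N2′) AND `4π ≤ C68`**: for every `k ≤ K` and admissible `h` there are
`U ∈ regClassC k h ∩ large67Set k h` and `α₀` in [B7] Prop. 2's window at `d = 3`, `N = 2` such that every fine plaquette whose base point is within `ℓ¹`-distance `39·L^{i₀}` of
SOME SITE of `lam42 Ω(h) k i` (`i₀ ≤ i ≤ k`) is `α₀·(L^{i₀})⁻²`-small (witness: `profE`, `α₀ := C68·max_{i ≤ k} a_i`).  The unguarded row reads `distTo (lam42 …) q.src ≤ 39·L^{i₀}`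
with `distTo ∅ = 0` — global smallness at a history with an empty read region — and is not what the interface uses.
[cite: Balaban1985UV3, (39)–(42) p.266 + (67)–(68) p.273; Balaban1985Variational, (2)+(8) pp.278–279; Balaban1985Averaging, Prop. 2 (52) p.26] -/
theorem AlphaInputsT3AC.exists_regular_large_nearSmall_of_collar (hN2 : CollarE (T3Scales F γ hγ (hγ1.trans (sq_min_one_le _ 𝔠.gamma0_pos)) K) 𝔠 K)
    (hC : 4 * Real.pi ≤ 𝔠.C68) {k : ℕ} (hk : k ≤ K) (h : Hist (F.P K) k)
    (hh : Hist.Admissible 𝔠.lane.carrier.M₁ (rcolOf (T3Scales F γ hγ (hγ1.trans (sq_min_one_le _ 𝔠.gamma0_pos)) K) 𝔠.lane.carrier) k h) :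
    ∃ U : GaugeField (F.P K) 0 (Matrix.specialUnitaryGroup (Fin 2) ℂ),
      U ∈ regClassC (S := T3Scales F γ hγ (hγ1.trans (sq_min_one_le _ 𝔠.gamma0_pos)) K) (suGroupModel 2) 𝔠 k h ∧
      U ∈ AlphaInputsT3AC.large67Set F 𝔠 γ hγ hγ1 K k h ∧
      ∃ α₀ : ℝ, 0 < α₀ ∧ (143 * ((((3 + 4 : ℕ) : ℝ)) ^ 2 / 4) ^ 2) * α₀ ≤ 1 / 3 ∧
        2 * α₀ ≤ 2 * deltaSU (Fin 2) / (((3 + 4) * F.L : ℕ) : ℝ) ^ 2 ∧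
        ((((3 + 2) * F.L : ℕ) : ℝ) ^ 2 / 4) * (α₀ + 2 * (143 * ((((3 + 4 : ℕ) : ℝ)) ^ 2 / 4) ^ 2) * α₀ ^ 2) ≤ deltaSU (Fin 2) / 2 ∧
        ∀ i₀ i : ℕ, i₀ ≤ i → i ≤ k → ∀ q : Plaq (F.P K) 0,
          ∀ y ∈ lam42 (Omega 𝔠.lane.carrier.M₁ (rcolOf (T3Scales F γ hγ (hγ1.trans (sq_min_one_le _ 𝔠.gamma0_pos)) K) 𝔠.lane.carrier) k h) k i,
            Site.tdist q.src y ≤ 39 * F.L ^ i₀ → dist1 (GaugeField.plaqHol U q) < α₀ * (((F.L : ℝ) ^ i₀)⁻¹) ^ 2 := by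
  classical
  set S : Scales F.L := T3Scales F γ hγ (hγ1.trans (sq_min_one_le _ 𝔠.gamma0_pos)) K with hS
  obtain ⟨X, hX, hX0⟩ := exists_ne_zero_mem_lie_su (N := 2) le_rfl
  have hR : CollarE S 𝔠 k := collarE_mono S 𝔠 hN2 hk
  have hkS : k ≤ S.K := hk
  obtain ⟨im, him, hmax⟩ := Finset.exists_max_image (Finset.range (k + 1)) (aj S 𝔠) ⟨0, by simp⟩
  have himk : im ≤ k := Nat.lt_succ_iff.mp (Finset.mem_range.mp him)
  obtain ⟨hα, hα3, hα2, hδ⟩ := AlphaInputsT3AC.b7WindowNear_T3 (F := F) (𝔠 := 𝔠) (γ := γ) (hγ := hγ) (hγ1 := hγ1) (K := K) (himk.trans hk)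
  refine ⟨profE S 𝔠 h hX, profE_mem_regClassC S 𝔠 h hX hX0 hkS hR,
    hLarge_profE S 𝔠 h hX hX0 hkS hR (AlphaInputsT3AC.smallOK_T3 (𝔠 := 𝔠) (hγ1 := hγ1) hk) hC hh, _, hα, hα3, hα2, hδ,
    fun i₀ i hi₀ hi q y hy hd => ?_⟩
  have hT := lam42_subset_of_le (Omega 𝔠.lane.carrier.M₁ (rcolOf S 𝔠.lane.carrier) k h) hi
  have hle := dist1_plaqHol_profE_le_near S 𝔠 hX h hX0 hkS hR hi₀ hi hT q hy hd
  refine lt_of_le_of_lt hle ?_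
  have hai : aj S 𝔠 i ≤ aj S 𝔠 im := hmax i (Finset.mem_range.mpr (Nat.lt_succ_of_le hi))
  have haim : 0 < aj S 𝔠 im := aj_pos S 𝔠 (himk.trans hk)
  have hC0 : 0 < 𝔠.C68 := 𝔠.C68_pos
  have hL0 : (0 : ℝ) < ((F.L : ℝ) ^ i₀)⁻¹ := by
    have : (0 : ℝ) < F.L := by exact_mod_cast (zero_lt_one.trans F.hL.2)
    positivity
  have hlt : 𝔠.C68 / 2 * aj S 𝔠 i < 𝔠.C68 * aj S 𝔠 im := by nlinarith
  exact mul_lt_mul_of_pos_right hlt (by positivity)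

end T3

end Summit.QuantumFields.YangMills.Theorems

end
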